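import Summits.QuantumFields.YangMills.Theorems.BalabanUVNodesN21LowCentreNumeral
import Summits.QuantumFields.YangMills.Theorems.BalabanUVNodesN21ImpliedLetters
import Literature.MathematicalPhysics.QuantumFieldTheory.Balaban1983to89.B15Ineq148Proof

/-!
# N21 (NE7c) · THE LOCATED NUMERAL AT THE (1.46) LETTERS AND UNIFORMLY IN THE HISTORY
# (plan g77 W-SEAT-START-LIST v3 §n21 item 1, second half: [LF-I] p.186 (1.45)–(1.47) letters, ME #31)

Width seat pub-ymgap-dag-n21-w1 (g0; director-ym №197 ∕ HUMAN RULING D-0149), node N21 = NE7c (single-run shell-weight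
bound, NOT PRINTED in [Bałaban 1983–89], NOT proved), lane K3⁷ `SpineGivenEndpointR13SepCoPH` (stmt-QuantumFields-20544,
`--kind proof --supports … --as helper`).  Sequel of `…N21LowCentreNumeral` (p583903: the numeral
`2G∕γ ≤ l₀(θ(1−ρ)−c₀)∕L` of n21-d part 30 `lowCentre_certificate` at the (1.48)∕(1.49) letters).  Consumes BY NAME the
PROVED rows of [Balaban1989LargeFieldI] p.186 in the tree — `B15.PrelimIntegrations.Ineq146` ∕ `Ineq147`,
`B15.BasicStep.Ineq148`, `B15Ineq148Proof.ineq148_of_146_147`, `exp_factor_le_half_pow` — and n21-d part 23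
`…N21ImpliedLetters.prod_one_add_geom_le_exp`.

WHAT.  §1 `numeral_of_letterBounds`: with the slot letter `θ = (1 − β(1 − s∕2))·P·E` ((1.49)), ANY core reading
`c₀ ≤ E∕16` and ANY modulus `0 < L ≤ 16∕15` give the numeral from the one clause `24·G ≤ γ·E` (print's `0 ≤ β ≤ ½`,
`s ≥ 0`, `P ≥ 1`, relative shell width `ρ ≤ ½`, contraction `l₀ ≥ ½`).  §2 THE (1.46) LETTERS AS PRINTED (ME #31,
desk l.22889 ∕ l.22903 ∕ l.22908: `B₃`, `ratio = A₁p₁(g_j)∕A₀p₀(g_j)`, `β₀`, `L^{−i}`, `δ′_j`, `δ`, `d`, `M∕M₁`, scale gap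
`g = j − i`): under print's two majorisations `9B₃·ratio·(1+β₀) ≤ αβ`, `8B₃L^{−i}δ′_j ≤ αβ` and «`M` large enough, so
that `δ(M∕M₁) ≥ 2`» the (1.46) additive term is `≤ αβ2^{−g}·εE` (`tilt146_le`, via `ineq148_of_146_147` at a vanishing
new deviation) and the (1.46) multiplicative factor is `≤ 1 + αβ2^{−g}` (`modulus146_le`); hence ★ `numeral_at146Letters`:
a core reading bounded by the (1.46) term and a modulus equal to the (1.46) factor give the numeral from `24·G ≤ γ·εE`.
§3 UNIFORMLY IN THE HISTORY (lens N210 «history sum ≤ αβ»; n21-d G38 `relativeTilt_history_le` is the same geometric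
sum, cited not imported): a core reading bounded by the SUM of the tilts `αβ2^{−(m+1)}·E` over any number `n` of older
steps and a modulus bounded by the PRODUCT of the factors `1 + αβ2^{−(m+1)}` (`≤ e^{αβ} ≤ 16∕15`) still give the
numeral from `24·G ≤ γ·E` — the located clause is K- and history-uniform (★ `numeral_of_historyLetters`).  §4 A6: print's
located antecedent of §2 is JOINTLY INHABITED (`letters146_numeral_fires`, clause at equality).

HONEST FRAMING.  [textbook] real arithmetic + by-name citation of PROVED B15 rows; 0 def, 0 sorry; `G` (gradient residual
of the non-quadratic block action, [CMP 116] ∕ [LF-II] (1.5)–(1.9)), `γ = γ₀` ([CMP 99] p.428 ∕ [CMP 96] (2.157)) and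
every printed letter are HYPOTHESES ∕ print's numerics (desk ROW Q′ l.23652, lens N210∕N212) — LOCATED, nothing of
Bałaban's asserted; NE7c NOT PRINTED ∕ NOT proved; N21 NOT discharged; counts unmoved (typed 28∕28 · discharged 5∕27);
count-neutral; one finite 𝕋⁴ at fixed ε — R4 would close only the conditional finite-𝕋⁴ rung `BalabanLadder.UV`, NOT the
Yang–Mills mass gap (Clay); nothing about ℝ⁴ ∕ OS.
-/

set_option autoImplicit false

open Finset

namespace Summit.QuantumFields.YangMills.Theorems.N21LowCentreNumeralSeam

open Literature.MathematicalPhysics.QuantumFieldTheory.Balaban1983to89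
open Literature.MathematicalPhysics.QuantumFieldTheory.Balaban1983to89.B15.PrelimIntegrations (Ineq146 Ineq147)
open Literature.MathematicalPhysics.QuantumFieldTheory.Balaban1983to89.B15Ineq148Proof
  (ineq148_of_146_147 exp_factor_le_half_pow)
open Summit.QuantumFields.YangMills.Theorems.N21LowCentreNumeral
  (coreReading_le_of_ineq148_at_centre half_le_recordContraction)
open Summit.QuantumFields.YangMills.Theorems.N21ImpliedLetters (prod_one_add_geom_le_exp)

/-! ## §1  The numeral from letter BOUNDS (core reading ≤ E∕16, modulus ≤ 16∕15) -/

section LetterBounds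

/-- **THE NUMERAL FROM LETTER BOUNDS.**  Slot letter `θ = (1 − β(1 − s∕2))·P·E` ((1.49): `P = L₀^{2max{0,i−k₀−1}} ≥ 1`,
`E = ε_i(L^{k−i}η)² ≥ 0`), print's `0 ≤ β ≤ ½`, `0 ≤ s`, relative shell width `ρ ≤ ½`, contraction `l₀ ≥ ½`, ANY core
reading `c₀ ≤ E∕16` and ANY modulus `0 < L ≤ 16∕15`: the clause `24·G ≤ γ·E` gives the located numeral
`2G∕γ ≤ l₀·(θ(1−ρ) − c₀)∕L` of `lowCentre_certificate`. [textbook] -/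
theorem numeral_of_letterBounds {G γ β s P E ρ l₀ c₀ L : ℝ} (hγ : 0 < γ) (hβ0 : 0 ≤ β) (hβ : β ≤ 1 / 2)
    (hs0 : 0 ≤ s) (hP : 1 ≤ P) (hE : 0 ≤ E) (hρ : ρ ≤ 1 / 2) (hl₀ : 1 / 2 ≤ l₀)
    (hc₀ : c₀ ≤ E / 16) (hL0 : 0 < L) (hL : L ≤ 16 / 15) (hG : 24 * G ≤ γ * E) :
    2 * G / γ ≤ l₀ * (((1 - β * (1 - s / 2)) * P * E * (1 - ρ) - c₀) / L) := by
  have hc : 1 / 2 ≤ 1 - β * (1 - s / 2) := by nlinarith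
  have hcP : 1 / 2 ≤ (1 - β * (1 - s / 2)) * P := by nlinarith
  have hE1 : 0 ≤ E * (1 - ρ) := mul_nonneg hE (by linarith)
  have h1 : 1 / 4 * E ≤ (1 - β * (1 - s / 2)) * P * E * (1 - ρ) := by
    have h := mul_le_mul_of_nonneg_right hcP hE1
    nlinarith
  set M : ℝ := (1 - β * (1 - s / 2)) * P * E * (1 - ρ) - c₀ with hMdef
  have hM : 3 / 16 * E ≤ M := by linarith
  have h2 : 2 * G / γ ≤ E / 12 := by
    rw [div_le_iff₀ hγ]
    linarith
  have h3 : 45 * E / 256 ≤ M / L := by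
    rw [le_div_iff₀ hL0]
    nlinarith
  have h4 : 0 ≤ M / L := le_trans (by positivity) h3
  have h5 : 1 / 2 * (M / L) ≤ l₀ * (M / L) := mul_le_mul_of_nonneg_right hl₀ h4
  linarith

end LetterBounds

/-! ## §2  The (1.46) letters, AS PRINTED -/

section Letters146

/-- **THE (1.46) ADDITIVE TERM IS AT MOST `αβ2^{−g}·εE`** ([LF-I] p.186: (1.46) ∧ (1.47) ∧ «`δ(M∕M₁) ≥ 2`» ∧ the
majorisation `9B₃(A₁p₁(g_j))∕(A₀p₀(g_j))(1 + β₀) ≤ αβ` ⇒ (1.48)'s additive coefficient): the exterior-induced reading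
`9B₃·ratio·(1+β₀)·(1 + g^{1∕2})·e^{−δd}·εE` of a configuration whose NEW deviation vanishes is `≤ αβ(½)^g·εE` — the tree's
`B15Ineq148Proof.ineq148_of_146_147` at `dev′ = 0` (its `L^{−i}`∕`δ′_j` letters set to `0`) read through
`coreReading_le_of_ineq148_at_centre`, BY NAME. [textbook] -/
theorem tilt146_le {B₃ ratio β₀ δ dist M M₁ α β εE : ℝ} {g : ℕ}
    (h147 : 0 < g → Ineq147 δ dist M M₁ (g : ℝ)) (hδd : 0 ≤ δ * dist) (hM : 2 ≤ δ * (M / M₁))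
    (hα₁ : 9 * B₃ * ratio * (1 + β₀) ≤ α * β) (hαβ : 0 ≤ α * β) (hεE : 0 ≤ εE) :
    9 * B₃ * ratio * (1 + β₀) * (1 + (g : ℝ) ^ (1 / 2 : ℝ)) * Real.exp (-(δ * dist)) * εE
      ≤ α * β * (1 / 2 : ℝ) ^ g * εE := by
  have h146 : Ineq146 (9 * B₃ * ratio * (1 + β₀) * (1 + (g : ℝ) ^ (1 / 2 : ℝ)) * Real.exp (-(δ * dist)) * εE)
      0 B₃ 0 δ dist 0 ratio β₀ (g : ℝ) εE := by
    unfold Ineq146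
    simp
  have h148 := ineq148_of_146_147 h146 h147 hδd hM hα₁ (by simpa using hαβ) (by simp) le_rfl hεE
  exact coreReading_le_of_ineq148_at_centre h148

/-- **THE (1.46) MULTIPLICATIVE FACTOR IS AT MOST `1 + αβ2^{−g}`** ([LF-I] p.186: «The numerical factor
`8B₃L^{−i}δ′_j < 8B₃γA₁p₁(γ)` can be also chosen arbitrarily small … a bound for these two factors in the form αβ» ∧ (1.47)
∧ «`δ(M∕M₁) ≥ 2`»): `0 < 1 + 8B₃L^{−i}e^{−δd}δ′_j ≤ 1 + αβ(½)^g` — (1.47) and `exp_factor_le_half_pow` BY NAME.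
[textbook] -/
theorem modulus146_le {B₃ Linv δ'j δ dist M M₁ α β : ℝ} {g : ℕ}
    (h147 : 0 < g → Ineq147 δ dist M M₁ (g : ℝ)) (hδd : 0 ≤ δ * dist) (hM : 2 ≤ δ * (M / M₁))
    (hα₂ : 8 * B₃ * Linv * δ'j ≤ α * β) (hF₂ : 0 ≤ 8 * B₃ * Linv * δ'j) :
    0 < 1 + 8 * B₃ * Linv * Real.exp (-(δ * dist)) * δ'j
      ∧ 1 + 8 * B₃ * Linv * Real.exp (-(δ * dist)) * δ'j ≤ 1 + α * β * (1 / 2 : ℝ) ^ g := by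
  have hexp : Real.exp (-(δ * dist)) ≤ (1 / 2 : ℝ) ^ g := by
    rcases Nat.eq_zero_or_pos g with hg | hg
    · subst hg
      rw [pow_zero, ← Real.exp_zero]
      exact Real.exp_le_exp.2 (by linarith)
    · have h1 : Real.exp (-(δ * dist)) ≤ Real.exp (-(δ * (M / M₁) * (g : ℝ))) := by
        have h := h147 hg
        unfold Ineq147 at h
        exact h
      have h2 : Real.exp (-(δ * (M / M₁) * (g : ℝ))) ≤ (1 + (g : ℝ) ^ (1 / 2 : ℝ)) * Real.exp (-(δ * (M / M₁) * g)) :=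
        le_mul_of_one_le_left (Real.exp_nonneg _) (by
          have : 0 ≤ (g : ℝ) ^ (1 / 2 : ℝ) := by positivity
          linarith)
      exact h1.trans (h2.trans (exp_factor_le_half_pow g hM))
  have hrw : 8 * B₃ * Linv * Real.exp (-(δ * dist)) * δ'j = 8 * B₃ * Linv * δ'j * Real.exp (-(δ * dist)) := by ring
  refine ⟨?_, ?_⟩
  · rw [hrw]
    have : 0 ≤ 8 * B₃ * Linv * δ'j * Real.exp (-(δ * dist)) := mul_nonneg hF₂ (Real.exp_nonneg _)
    linarith
  · rw [hrw]
    have h := mul_le_mul hα₂ hexp (Real.exp_nonneg _) (hF₂.trans hα₂)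
    linarith

/-- ★ **THE NUMERAL AT THE (1.46) LETTERS, AS PRINTED.**  Slot letter `θ = (1 − β(1 − 2^{−g}∕2))·P·εE` ((1.49) at
level `n`, gap `g = j − i`), a core reading bounded by the (1.46) additive term
`c₀ ≤ 9B₃·ratio·(1+β₀)(1+g^{1∕2})e^{−δd}·εE` and the (1.46) modulus `L = 1 + 8B₃L^{−i}e^{−δd}δ′_j`, print's (1.47),
«`δ(M∕M₁) ≥ 2`», the two majorisations by `αβ` with `0 ≤ α ≤ 1∕8`, `0 ≤ β ≤ ½`, `P ≥ 1`, `εE ≥ 0`, relative shell width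
`ρ ≤ ½`, contraction `l₀ ≥ ½`: the clause `24·G ≤ γ·εE` gives the located numeral of `lowCentre_certificate`
(G, γ₀ LOCATED at the desk's ROW Q′; nothing of Bałaban's asserted). [textbook] -/
theorem numeral_at146Letters {G γ B₃ ratio β₀ Linv δ'j δ dist M M₁ α β P εE ρ l₀ c₀ : ℝ} {g : ℕ} (hγ : 0 < γ)
    (h147 : 0 < g → Ineq147 δ dist M M₁ (g : ℝ)) (hδd : 0 ≤ δ * dist) (hM : 2 ≤ δ * (M / M₁))
    (hα₁ : 9 * B₃ * ratio * (1 + β₀) ≤ α * β) (hα₂ : 8 * B₃ * Linv * δ'j ≤ α * β)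
    (hF₂ : 0 ≤ 8 * B₃ * Linv * δ'j) (hα0 : 0 ≤ α) (hα : α ≤ 1 / 8) (hβ0 : 0 ≤ β) (hβ : β ≤ 1 / 2)
    (hP : 1 ≤ P) (hεE : 0 ≤ εE) (hρ : ρ ≤ 1 / 2) (hl₀ : 1 / 2 ≤ l₀)
    (hc₀ : c₀ ≤ 9 * B₃ * ratio * (1 + β₀) * (1 + (g : ℝ) ^ (1 / 2 : ℝ)) * Real.exp (-(δ * dist)) * εE)
    (hG : 24 * G ≤ γ * εE) :
    2 * G / γ ≤ l₀ * (((1 - β * (1 - (1 / 2 : ℝ) ^ g / 2)) * P * εE * (1 - ρ) - c₀)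
      / (1 + 8 * B₃ * Linv * Real.exp (-(δ * dist)) * δ'j)) := by
  have hαβ0 : 0 ≤ α * β := mul_nonneg hα0 hβ0
  have hαβ : α * β ≤ 1 / 16 := by nlinarith [mul_le_mul hα hβ hβ0 (by norm_num : (0 : ℝ) ≤ 1 / 8)]
  have hs0 : 0 ≤ (1 / 2 : ℝ) ^ g := by positivity
  have hs1 : (1 / 2 : ℝ) ^ g ≤ 1 := pow_le_one₀ (by norm_num) (by norm_num)
  have htilt := tilt146_le h147 hδd hM hα₁ hαβ0 hεE
  obtain ⟨hL0, hL⟩ := modulus146_le (g := g) h147 hδd hM hα₂ hF₂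
  have hc₀' : c₀ ≤ εE / 16 := by
    have h1 : α * β * (1 / 2 : ℝ) ^ g * εE ≤ 1 / 16 * 1 * εE :=
      mul_le_mul_of_nonneg_right (mul_le_mul hαβ hs1 hs0 (by norm_num)) hεE
    linarith
  have hL' : 1 + 8 * B₃ * Linv * Real.exp (-(δ * dist)) * δ'j ≤ 16 / 15 := by
    have h1 : α * β * (1 / 2 : ℝ) ^ g ≤ 1 / 16 * 1 := mul_le_mul hαβ hs1 hs0 (by norm_num)
    linarith
  exact numeral_of_letterBounds hγ hβ0 hβ hs0 hP hεE hρ hl₀ hc₀' hL0 hL' hG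

/-- the same at the record's contraction `l₀ = 1 − 1∕(#κ+1)` (block of dimension `#κ ≥ 1`). [textbook] -/
theorem numeral_at146Letters_record (κ : Type*) [Fintype κ] [Nonempty κ]
    {G γ B₃ ratio β₀ Linv δ'j δ dist M M₁ α β P εE ρ c₀ : ℝ} {g : ℕ} (hγ : 0 < γ)
    (h147 : 0 < g → Ineq147 δ dist M M₁ (g : ℝ)) (hδd : 0 ≤ δ * dist) (hM : 2 ≤ δ * (M / M₁))
    (hα₁ : 9 * B₃ * ratio * (1 + β₀) ≤ α * β) (hα₂ : 8 * B₃ * Linv * δ'j ≤ α * β)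
    (hF₂ : 0 ≤ 8 * B₃ * Linv * δ'j) (hα0 : 0 ≤ α) (hα : α ≤ 1 / 8) (hβ0 : 0 ≤ β) (hβ : β ≤ 1 / 2)
    (hP : 1 ≤ P) (hεE : 0 ≤ εE) (hρ : ρ ≤ 1 / 2)
    (hc₀ : c₀ ≤ 9 * B₃ * ratio * (1 + β₀) * (1 + (g : ℝ) ^ (1 / 2 : ℝ)) * Real.exp (-(δ * dist)) * εE)
    (hG : 24 * G ≤ γ * εE) :
    2 * G / γ ≤ (1 - 1 / ((Fintype.card κ : ℝ) + 1)) *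
      (((1 - β * (1 - (1 / 2 : ℝ) ^ g / 2)) * P * εE * (1 - ρ) - c₀)
        / (1 + 8 * B₃ * Linv * Real.exp (-(δ * dist)) * δ'j)) :=
  numeral_at146Letters hγ h147 hδd hM hα₁ hα₂ hF₂ hα0 hα hβ0 hβ hP hεE hρ (half_le_recordContraction κ) hc₀ hG

end Letters146

/-! ## §3  Uniformly in the history: summed tilts, multiplied moduli -/

section History

/-- **THE HISTORY SUM OF THE TILTS IS AT MOST `αβ·E`**: `(Σ_{m<n} αβ2^{−(m+1)})·E ≤ αβ·E` for every number `n` of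
older steps (lens N210 «history sum ≤ αβ»; the same geometric sum as n21-d G38 `relativeTilt_history_le`, re-derived
from Mathlib's `sum_geometric_two_le`). [textbook] -/
theorem historyTilt_le {α β E : ℝ} (hα : 0 ≤ α) (hβ : 0 ≤ β) (hE : 0 ≤ E) (n : ℕ) :
    (∑ m ∈ range n, α * β * (1 / 2 : ℝ) ^ (m + 1)) * E ≤ α * β * E := by
  have hgeom : ∑ m ∈ range n, (1 / 2 : ℝ) ^ (m + 1) ≤ 1 := by
    have h := sum_geometric_two_le n
    have hre : ∑ m ∈ range n, (1 / 2 : ℝ) ^ (m + 1) = 1 / 2 * ∑ m ∈ range n, (1 / 2 : ℝ) ^ m := by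
      rw [mul_sum]
      exact sum_congr rfl fun m _ => by ring
    rw [hre]
    linarith
  have hsum : ∑ m ∈ range n, α * β * (1 / 2 : ℝ) ^ (m + 1) = α * β * ∑ m ∈ range n, (1 / 2 : ℝ) ^ (m + 1) := by
    rw [mul_sum]
  rw [hsum]
  have hαβ : 0 ≤ α * β := mul_nonneg hα hβ
  have h1 : α * β * ∑ m ∈ range n, (1 / 2 : ℝ) ^ (m + 1) ≤ α * β * 1 := mul_le_mul_of_nonneg_left hgeom hαβ
  nlinarith

/-- **THE HISTORY PRODUCT OF THE MODULI IS AT MOST `e^{αβ} ≤ 16∕15`**: `0 < ∏_{m<n}(1 + αβ2^{−(m+1)}) ≤ 16∕15` under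
print's `0 ≤ α ≤ 1∕8`, `0 ≤ β ≤ ½` — n21-d part 23 `prod_one_add_geom_le_exp` BY NAME (`∏(1 + t2^{−d}) ≤ e^{2t}`,
`t = αβ∕2`) and `e^{x} ≤ 1∕(1−x)`. [textbook] -/
theorem historyModulus_le {α β : ℝ} (hα0 : 0 ≤ α) (hα : α ≤ 1 / 8) (hβ0 : 0 ≤ β) (hβ : β ≤ 1 / 2) (n : ℕ) :
    0 < ∏ m ∈ range n, (1 + α * β * (1 / 2 : ℝ) ^ (m + 1))
      ∧ ∏ m ∈ range n, (1 + α * β * (1 / 2 : ℝ) ^ (m + 1)) ≤ 16 / 15 := by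
  have hαβ0 : 0 ≤ α * β := mul_nonneg hα0 hβ0
  have hαβ : α * β ≤ 1 / 16 := by nlinarith [mul_le_mul hα hβ hβ0 (by norm_num : (0 : ℝ) ≤ 1 / 8)]
  refine ⟨prod_pos fun m _ => by positivity, ?_⟩
  have hre : ∏ m ∈ range n, (1 + α * β * (1 / 2 : ℝ) ^ (m + 1))
      = ∏ m ∈ range n, (1 + α * β / 2 * (1 / 2 : ℝ) ^ m) :=
    prod_congr rfl fun m _ => by rw [pow_succ]; ring
  rw [hre]
  have h1 := prod_one_add_geom_le_exp (show (0 : ℝ) ≤ α * β / 2 by positivity) n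
  have h2 : Real.exp (2 * (α * β / 2)) ≤ Real.exp (1 / 16) := Real.exp_le_exp.2 (by linarith)
  have h3 : Real.exp (1 / 16) ≤ 16 / 15 := by
    have h := Real.add_one_le_exp (-(1 / 16 : ℝ))
    have hpos : 0 < Real.exp (-(1 / 16 : ℝ)) := Real.exp_pos _
    have hinv : Real.exp (1 / 16) = (Real.exp (-(1 / 16 : ℝ)))⁻¹ := by
      rw [← Real.exp_neg]; ring_nf
    rw [hinv, inv_le_comm₀ hpos (by norm_num)]
    linarith
  exact h1.trans (h2.trans h3)

/-- ★ **THE NUMERAL, UNIFORMLY IN THE HISTORY.**  Slot letter `θ = (1 − β(1 − s∕2))·P·E` ((1.49)), a core reading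
bounded by the SUM of the exterior tilts over any number `n` of older steps, `c₀ ≤ (Σ_{m<n} αβ2^{−(m+1)})·E`, and a
modulus bounded by the PRODUCT of the (1.48) factors, `0 < L ≤ ∏_{m<n}(1 + αβ2^{−(m+1)})`, print's `0 ≤ α ≤ 1∕8`,
`0 ≤ β ≤ ½`, `0 ≤ s`, `P ≥ 1`, `E ≥ 0`, `ρ ≤ ½`, `l₀ ≥ ½`: the SAME clause `24·G ≤ γ·E` gives the numeral for EVERY
`n` — the located clause of the low-centre road is uniform in the history length (hence in `K`). [textbook] -/
theorem numeral_of_historyLetters {G γ α β s P E ρ l₀ c₀ L : ℝ} (n : ℕ) (hγ : 0 < γ) (hα0 : 0 ≤ α)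
    (hα : α ≤ 1 / 8) (hβ0 : 0 ≤ β) (hβ : β ≤ 1 / 2) (hs0 : 0 ≤ s) (hP : 1 ≤ P) (hE : 0 ≤ E)
    (hρ : ρ ≤ 1 / 2) (hl₀ : 1 / 2 ≤ l₀)
    (hc₀ : c₀ ≤ (∑ m ∈ range n, α * β * (1 / 2 : ℝ) ^ (m + 1)) * E) (hL0 : 0 < L)
    (hL : L ≤ ∏ m ∈ range n, (1 + α * β * (1 / 2 : ℝ) ^ (m + 1))) (hG : 24 * G ≤ γ * E) :
    2 * G / γ ≤ l₀ * (((1 - β * (1 - s / 2)) * P * E * (1 - ρ) - c₀) / L) := by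
  have hαβ : α * β ≤ 1 / 16 := by nlinarith [mul_le_mul hα hβ hβ0 (by norm_num : (0 : ℝ) ≤ 1 / 8)]
  have hc₀' : c₀ ≤ E / 16 := by
    have h1 := historyTilt_le hα0 hβ0 hE n
    have h2 : α * β * E ≤ 1 / 16 * E := mul_le_mul_of_nonneg_right hαβ hE
    linarith
  have hL' : L ≤ 16 / 15 := hL.trans (historyModulus_le hα0 hα hβ0 hβ n).2
  exact numeral_of_letterBounds hγ hβ0 hβ hs0 hP hE hρ hl₀ hc₀' hL0 hL' hG

end History

/-! ## §4  A6: print's located antecedent of §2 is jointly inhabited (clause at equality) -/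

section Witness

/-- **A6 (director-ym STANDING A6 RULE №189 (3)): THE (1.46)-LETTER ANTECEDENT IS JOINTLY INHABITED.**
`numeral_at146Letters` FIRES at `B₃ = 1`, `ratio = 1∕288`, `β₀ = 0`, `α = ⅛`, `β = ¼` (so `9B₃·ratio·(1+β₀) = αβ = 1∕32`),
`L^{−i} = 1`, `δ′_j = 1∕256` (`8B₃L^{−i}δ′_j = 1∕32`), `δ = 2`, `d = 1`, `M = M₁ = 1` (`δM∕M₁ = 2`, (1.47) with equality at
gap `g = 1`), `P = εE = 1`, `ρ = ½`, `l₀ = ½`, `γ = 1`, `G = 1∕24` (the clause `24·G ≤ γ·εE` WITH EQUALITY), core reading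
`c₀ =` the (1.46) term itself.  A satisfiability witness of the located letter system, not an estimate on Bałaban's
objects. [textbook] -/
theorem letters146_numeral_fires :
    2 * (1 / 24 : ℝ) / 1 ≤ 1 / 2 * (((1 - 1 / 4 * (1 - (1 / 2 : ℝ) ^ (1 : ℕ) / 2)) * 1 * 1 * (1 - 1 / 2)
      - 9 * 1 * (1 / 288) * (1 + 0) * (1 + ((1 : ℕ) : ℝ) ^ (1 / 2 : ℝ)) * Real.exp (-(2 * 1)) * 1)
      / (1 + 8 * 1 * 1 * Real.exp (-(2 * 1)) * (1 / 256))) := by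
  refine numeral_at146Letters (M := 1) (M₁ := 1) (α := 1 / 8) (β := 1 / 4) (β₀ := 0) (ratio := 1 / 288)
    (g := 1) one_pos ?_ (by norm_num) (by norm_num) (by norm_num) (by norm_num) (by norm_num) (by norm_num)
    (by norm_num) (by norm_num) (by norm_num) le_rfl (by norm_num) (by norm_num) le_rfl le_rfl (by norm_num)
  intro _
  unfold Ineq147
  exact Real.exp_le_exp.2 (by norm_num)

end Witness

end Summit.QuantumFields.YangMills.Theorems.N21LowCentreNumeralSeam
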